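import Summits.Ventures.PercRepro.LineC

/-!
# PercRepro — LINE C″: mine-1's MIN-FACE lemma for single-merge maps gives Lemma B, hence C-005 (typer-2, gen 4–5)

mine-1 (08:27Z, INBOX): for every single-merge map `c` on the `d`-cube and every coordinate `k`,
`CS_B(c) ≥ min(CS_B(c|x_k=0), CS_B(c|x_k=1))` — the class sum is never below BOTH facets
(no violation for any single-merge map at `d = 4, …, 8`: j155486–92, j156098, j156097).

mine-1 (08:55:53Z, `proofs/MINE1-singlemerge.md` §10.2–10.3; adopted by the lead 08:56:58Z, ASSIGNMENTS
v32 typer-2 (a)): the step along `k` carries no information — single merge along the split coordinate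
is irrelevant (UNSAT with jumps along `k` at `d = 5, 6, 7`, j157492/6/8), while single merge ONLY along
`k` fails (j157501/3). MIN-FACE is therefore a statement about the two FACES: for single-merge maps
`c₀ ≤ c₁` (pointwise, arbitrary gaps) on the `(d−1)`-cube, the CROSS CLASS SUM
`X(c₀, c₁) := Σ_A K(c₀(A), c₁(Ā))` satisfies `X(c₀, c₁) ≥ min(½ X(c₀, c₀), ½ X(c₁, c₁))` — «the cross
sum of two comparable single-merge maps is at least half the smaller self-sum». The pointwise order is
needed (§10.3: unrelated pairs give `X < min`, even `X < 0`).

This file types both forms on the `LineC.lean` vocabulary and runs the dimension induction.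

* `facetBot` — the BOTTOM FACET `x_k = 0` (the twin of `facetTop`); `facetBot_singleMergeMap`;
  `restrictAt` / `splitAt` — the cube splits along `k` as `Bool × (cube without k)`;
* `crossSum K c₀ c₁ = Σ_ρ K (c₀ ρ) (c₁ ρᶜ)` — the cross class sum (`crossSum_self`: `X(c, c) = CS(c)`,
  the ORDERED cube sum, so `CS_B(c) = X(c, c)` here and mine-1's `½ X(c_i, c_i)` is `½ cubeSumB c_i`);
  `crossKernel_comm` / `nestedKernel_comm` (the kernel is symmetric), `crossSum_comm`;
* **`cubeSum_eq_crossSum_facets`** — `CS(c) = X(c|x_k=0, c|x_k=1) + X(c|x_k=1, c|x_k=0)`, so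
  **`cubeSumB_eq_two_mul_crossSumB`**: `CS_B(c) = 2 · X(facetBot c k, facetTop c k)`;
* `facetBot_le_facetTop` — the facets of a single-merge map are pointwise comparable;
* **`SingleMergeMinFace`** — MIN-FACE in mine-1's BILINEAR shape (a `Prop`, unproved here): two
  single-merge maps on one cube, `c₀ ≤ c₁` pointwise, `min(CS_B(c₀), CS_B(c₁)) ≤ 2 · X(c₀, c₁)`
  (i.e. `X(c₀, c₁) ≥ min(½ CS_B(c₀), ½ CS_B(c₁))`, `singleMergeMinFace_half_form`);
* **`SingleMergeMinFaceFacet`** — the FACET form (stamp 60): `min(CS_B(c|x_k=0), CS_B(c|x_k=1)) ≤ CS_B(c)`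
  for every single-merge `c` and coordinate `k`; **`minFaceFacet_of_minFace`** — the bilinear form
  implies it (take `c₀ = facetBot c k`, `c₁ = facetTop c k`);
* **`lemmaB_singleMerge_of_minFaceFacet`** / **`lemmaB_singleMerge_of_minFace`** — `0 ≤ CS_B(c)` for every
  single-merge map by induction on `card S` (both facets are single-merge maps of one dimension less;
  the 0-cube has `CS_B = 0`);
* **`C005_of_minFaceFacet`** / **`C005_of_minFace`** — so MIN-FACE (either form) in every dimension closes C-005.

MIN-FACE is weaker than `SingleMergeContractionMono` (`CS_B(facetTop c k) ≤ CS_B(c)` at every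
`k` — FALSE abstractly at `d = 8`, p4 j155997) and than its `∃k` form: the facet form is implied by
either (`minFaceFacet_of_contractionMono`).
-/

namespace PercRepro

open Finset

section Facet

variable {S ι : Type*} [DecidableEq S]

/-- The BOTTOM FACET `x_k = 0` of a cube map, as a map on the cube of the other coordinates. -/
def facetBot (c : Config S → ι) (k : S) : Config {s // s ≠ k} → ι :=
  fun σ => c (extendAt k false σ)

/-- Forget the coordinate `k` of a configuration. -/
def restrictAt (k : S) (σ : Config S) : Config {s // s ≠ k} := fun s => σ s.1

/-- `restrictAt` undoes `extendAt`. -/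
theorem restrictAt_extendAt (k : S) (b : Bool) (ρ : Config {s // s ≠ k}) :
    restrictAt k (extendAt k b ρ) = ρ := by
  funext s
  exact extendAt_of_ne k b ρ s.2

/-- `extendAt` at the own value of `k` undoes `restrictAt`. -/
theorem extendAt_restrictAt (k : S) (σ : Config S) : extendAt k (σ k) (restrictAt k σ) = σ := by
  funext s
  by_cases hs : s = k
  · subst hs
    exact extendAt_self s (σ s) _
  · rw [extendAt_of_ne k (σ k) _ hs]
    rfl

/-- The complement of an extended configuration extends the complement at the flipped bit. -/
theorem compl_extendAt (k : S) (b : Bool) (ρ : Config {s // s ≠ k}) :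
    (extendAt k b ρ)ᶜ = extendAt k (!b) ρᶜ := by
  funext s
  by_cases hs : s = k
  · subst hs
    rw [Pi.compl_apply, extendAt_self, extendAt_self]
    cases b <;> rfl
  · rw [Pi.compl_apply, extendAt_of_ne k b ρ hs, extendAt_of_ne k (!b) ρᶜ hs]
    rfl

/-- Making the coordinate `k` of an extension `true` is the extension by `true`. -/
theorem update_extendAt_false (k : S) (ρ : Config {s // s ≠ k}) :
    Function.update (extendAt k false ρ) k true = extendAt k true ρ := by
  funext s
  by_cases hs : s = k
  · subst hs
    rw [Function.update_self, extendAt_self]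
  · rw [Function.update_of_ne hs, extendAt_of_ne k false ρ hs, extendAt_of_ne k true ρ hs]

/-- The cube splits along the coordinate `k` as `Bool × (cube without k)`. -/
def splitAt (k : S) : Config S ≃ Bool × Config {s // s ≠ k} where
  toFun σ := (σ k, restrictAt k σ)
  invFun bρ := extendAt k bρ.1 bρ.2
  left_inv σ := extendAt_restrictAt k σ
  right_inv bρ := by
    obtain ⟨b, ρ⟩ := bρ
    simp only [extendAt_self, restrictAt_extendAt]

end Facet

section Split

variable {S : Type*} [Fintype S] [DecidableEq S]

/-- A sum over the cube splits into the sums over the two facets at `k`. -/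
theorem sum_config_eq_facets (k : S) (f : Config S → ℝ) :
    ∑ σ : Config S, f σ =
      ∑ ρ : Config {s // s ≠ k}, f (extendAt k false ρ) + ∑ ρ : Config {s // s ≠ k}, f (extendAt k true ρ) := by
  rw [← (splitAt k).symm.sum_comp, Fintype.sum_prod_type, Fintype.sum_bool, add_comm]
  rfl

end Split

section SingleMerge

variable {S : Type*} [DecidableEq S]

/-- The bottom facet of a single-merge map is a single-merge map. -/
theorem facetBot_singleMergeMap {c : Config S → Setoid (Fin 4)} (hc : SingleMergeMap c) (k : S) :
    SingleMergeMap (facetBot c k) := by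
  intro σ e he
  have h := hc (extendAt k false σ) e.1 (by rw [extendAt_of_ne k false σ e.2]; exact he)
  unfold facetBot
  rw [extendAt_update]
  exact h

/-- The two facets of a single-merge map are pointwise comparable: the bottom facet is finer. -/
theorem facetBot_le_facetTop {c : Config S → Setoid (Fin 4)} (hc : SingleMergeMap c) (k : S)
    (ρ : Config {s // s ≠ k}) : facetBot c k ρ ≤ facetTop c k ρ := by
  unfold facetBot facetTop
  rw [← update_extendAt_false k ρ]
  rcases hc (extendAt k false ρ) k (extendAt_self k false ρ) with h | ⟨i, j, -, hij⟩
  · rw [← h]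
  · rw [hij]
    exact le_mergeBlocks _ i j

end SingleMerge

/-! ### The cross class sum of two cube maps -/

section CrossSum

variable {S ι : Type*} [Fintype S] [DecidableEq S]

/-- The CROSS CLASS SUM `X(c₀, c₁) = Σ_ρ K (c₀ ρ) (c₁ ρᶜ)` of two cube maps (mine-1 §10.2): the
antipodal sum of the glued map, one facet against the other. -/
noncomputable def crossSum (K : ι → ι → ℝ) (c₀ c₁ : Config S → ι) : ℝ :=
  ∑ ρ : Config S, K (c₀ ρ) (c₁ ρᶜ)

/-- The cross sum of a map with itself is its (ordered) cube sum. -/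
theorem crossSum_self (K : ι → ι → ℝ) (c : Config S → ι) : crossSum K c c = cubeSum K c := rfl

/-- For a symmetric kernel the cross sum is symmetric (reindex by complementation). -/
theorem crossSum_comm {K : ι → ι → ℝ} (hK : ∀ a b, K a b = K b a) (c₀ c₁ : Config S → ι) :
    crossSum K c₀ c₁ = crossSum K c₁ c₀ := by
  unfold crossSum
  refine Fintype.sum_equiv (complPerm (S := S)) _ _ fun ρ => ?_
  simp only [complPerm, Function.Involutive.coe_toPerm, compl_compl]
  exact hK _ _

/-- **The cube sum splits along `k` into the two cross sums of its facets.** -/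
theorem cubeSum_eq_crossSum_facets (K : ι → ι → ℝ) (c : Config S → ι) (k : S) :
    cubeSum K c = crossSum K (facetBot c k) (facetTop c k) + crossSum K (facetTop c k) (facetBot c k) := by
  unfold cubeSum crossSum facetBot facetTop
  rw [sum_config_eq_facets k]
  congr 1
  · refine Finset.sum_congr rfl fun ρ _ => ?_
    rw [compl_extendAt]
    rfl
  · refine Finset.sum_congr rfl fun ρ _ => ?_
    rw [compl_extendAt]
    rfl

end CrossSum

/-! ### The Lemma-B kernel is symmetric -/

section KernelComm

variable {k r : ℕ}

open Classical in
/-- The two-copy kernel of any family is symmetric. -/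
theorem crossKernel_comm (x : Fin r → Setoid (Fin k)) (σ τ : Setoid (Fin k)) :
    crossKernel x σ τ = crossKernel x τ σ := by
  unfold crossKernel
  have h1 : (if σ = ⊤ ∧ τ = ⊥ then (1 : ℝ) else 0) = if τ = ⊥ ∧ σ = ⊤ then 1 else 0 := by
    by_cases h : σ = ⊤ ∧ τ = ⊥
    · rw [if_pos h, if_pos h.symm]
    · rw [if_neg h, if_neg fun h' => h h'.symm]
  have h2 : (if σ = ⊥ ∧ τ = ⊤ then (1 : ℝ) else 0) = if τ = ⊤ ∧ σ = ⊥ then 1 else 0 := by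
    by_cases h : σ = ⊥ ∧ τ = ⊤
    · rw [if_pos h, if_pos h.symm]
    · rw [if_neg h, if_neg fun h' => h h'.symm]
  have h3 : (∑ i : Fin r, ∑ j : Fin r, if i ≠ j ∧ τ = x i ∧ σ = x j then (1 : ℝ) else 0) =
      ∑ i : Fin r, ∑ j : Fin r, if i ≠ j ∧ σ = x i ∧ τ = x j then (1 : ℝ) else 0 := by
    rw [Finset.sum_comm]
    refine Finset.sum_congr rfl fun i _ => Finset.sum_congr rfl fun j _ => ?_
    by_cases h : i ≠ j ∧ σ = x i ∧ τ = x j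
    · rw [if_pos h, if_pos ⟨h.1.symm, h.2.2, h.2.1⟩]
    · rw [if_neg h, if_neg fun h' => h ⟨h'.1.symm, h'.2.2, h'.2.1⟩]
  rw [h1, h2, h3, add_comm]

/-- The kernel of `N` is symmetric. -/
theorem nestedKernel_comm (σ τ : Setoid (Fin 4)) : nestedKernel σ τ = nestedKernel τ σ :=
  crossKernel_comm cross4 σ τ

end KernelComm

section CrossSumB

variable {S : Type*} [Fintype S] [DecidableEq S]

/-- The Lemma-B cross class sum `X_B(c₀, c₁) = Σ_ρ K_N (c₀ ρ) (c₁ ρᶜ)` of two cube maps. -/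
noncomputable abbrev crossSumB (c₀ c₁ : Config S → Setoid (Fin 4)) : ℝ := crossSum nestedKernel c₀ c₁

/-- `X_B` is symmetric. -/
theorem crossSumB_comm (c₀ c₁ : Config S → Setoid (Fin 4)) : crossSumB c₀ c₁ = crossSumB c₁ c₀ :=
  crossSum_comm nestedKernel_comm c₀ c₁

/-- **`CS_B(c) = 2 · X_B(c|x_k=0, c|x_k=1)`** — the Lemma-B class sum of a cube map is twice the cross
sum of its two facets at any coordinate. -/
theorem cubeSumB_eq_two_mul_crossSumB (c : Config S → Setoid (Fin 4)) (k : S) :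
    cubeSumB c = 2 * crossSumB (facetBot c k) (facetTop c k) := by
  unfold cubeSumB
  rw [cubeSum_eq_crossSum_facets nestedKernel c k, crossSum_comm nestedKernel_comm (facetTop c k)]
  ring

end CrossSumB

/-- **MIN-FACE, bilinear shape** (mine-1 §10.2, 08:55:53Z; the statement of record since the lead's
08:56:58Z adoption): for two single-merge maps `c₀ ≤ c₁` (pointwise in the refinement order, with
ARBITRARY gaps — no adjacency, no cover condition) on one cube, the cross class sum is at least half
the smaller self-sum: `min(CS_B(c₀), CS_B(c₁)) ≤ 2 · X_B(c₀, c₁)`. (Here `CS_B = cubeSumB` is the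
ORDERED antipodal sum, `= X_B(c, c)`, so this is mine-1's `X(c₀,c₁) ≥ min(½X(c₀,c₀), ½X(c₁,c₁))`.)
UNSAT (no violation) at `d − 1 = 4, 5, 6` with jumps along the glued coordinate (j157492/6/8). -/
def SingleMergeMinFace : Prop :=
  ∀ {S : Type} [Fintype S] [DecidableEq S] (c₀ c₁ : Config S → Setoid (Fin 4)),
    SingleMergeMap c₀ → SingleMergeMap c₁ → (∀ ρ, c₀ ρ ≤ c₁ ρ) →
      min (cubeSumB c₀) (cubeSumB c₁) ≤ 2 * crossSumB c₀ c₁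

/-- The bilinear inequality in mine-1's «half» spelling: `X ≥ min(½ CS_B(c₀), ½ CS_B(c₁))`. -/
theorem singleMergeMinFace_half_form {S : Type} [Fintype S] [DecidableEq S]
    (c₀ c₁ : Config S → Setoid (Fin 4)) :
    min (cubeSumB c₀) (cubeSumB c₁) ≤ 2 * crossSumB c₀ c₁ ↔
      min (cubeSumB c₀ / 2) (cubeSumB c₁ / 2) ≤ crossSumB c₀ c₁ := by
  rw [min_div_div_right (by norm_num : (0 : ℝ) ≤ 2), div_le_iff₀ (by norm_num : (0 : ℝ) < 2)]
  exact ⟨fun h => by linarith, fun h => by linarith⟩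

/-- **MIN-FACE, facet form** (mine-1 08:27Z; stamp 60): for every single-merge map and every
coordinate `k`, the Lemma-B class sum is at least the smaller of the class sums of the two facets
at `k`. It is the bilinear form restricted to the ADJACENT pairs `(facetBot c k, facetTop c k)`. -/
def SingleMergeMinFaceFacet : Prop :=
  ∀ {S : Type} [Fintype S] [DecidableEq S] (c : Config S → Setoid (Fin 4)), SingleMergeMap c →
    ∀ k : S, min (cubeSumB (facetBot c k)) (cubeSumB (facetTop c k)) ≤ cubeSumB c

/-- **The bilinear form implies the facet form** (the facets of a single-merge map are single-merge
maps, pointwise comparable, and `CS_B(c) = 2 · X_B(facetBot c k, facetTop c k)`). -/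
theorem minFaceFacet_of_minFace (h : SingleMergeMinFace) : SingleMergeMinFaceFacet := by
  intro S _ _ c hc k
  rw [cubeSumB_eq_two_mul_crossSumB c k]
  exact h (facetBot c k) (facetTop c k) (facetBot_singleMergeMap hc k) (facetTop_singleMergeMap hc k)
    (facetBot_le_facetTop hc k)

/-- **The LINE C″ frame**: the facet form of MIN-FACE gives Lemma B for every single-merge map
(induction on the dimension of the cube; both facets are single-merge maps; the 0-cube has
`CS_B = 0`). -/
theorem lemmaB_singleMerge_of_minFaceFacet (h : SingleMergeMinFaceFacet) :
    ∀ {S : Type} [Fintype S] [DecidableEq S] (c : Config S → Setoid (Fin 4)), SingleMergeMap c →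
      0 ≤ cubeSumB c := by
  intro S _ _ c hc
  suffices key : ∀ n : ℕ, ∀ (S : Type) [Fintype S] [DecidableEq S], Fintype.card S = n →
      ∀ c : Config S → Setoid (Fin 4), SingleMergeMap c → 0 ≤ cubeSumB c from key _ S rfl c hc
  intro n
  induction n with
  | zero =>
    intro S _ _ hS c _
    have hempty : IsEmpty S := Fintype.card_eq_zero_iff.mp hS
    unfold cubeSumB cubeSum
    refine Finset.sum_nonneg fun ρ _ => ?_
    have hρ : ρᶜ = ρ := funext fun s => hempty.elim s
    rw [hρ, nestedKernel_self]
  | succ n ih =>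
    intro S _ _ hS c hc
    obtain ⟨k⟩ : Nonempty S := Fintype.card_pos_iff.mp (by omega)
    have hcard : Fintype.card {s // s ≠ k} = n := by
      have := Fintype.card_subtype_compl (fun s : S => s = k)
      rw [Fintype.card_subtype_eq, hS] at this
      simpa using this
    refine le_trans (le_min ?_ ?_) (h c hc k)
    · exact ih _ hcard (facetBot c k) (facetBot_singleMergeMap hc k)
    · exact ih _ hcard (facetTop c k) (facetTop_singleMergeMap hc k)

/-- **The LINE C″ frame, bilinear input**: MIN-FACE (bilinear shape) gives Lemma B for every
single-merge map. -/
theorem lemmaB_singleMerge_of_minFace (h : SingleMergeMinFace) :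
    ∀ {S : Type} [Fintype S] [DecidableEq S] (c : Config S → Setoid (Fin 4)), SingleMergeMap c →
      0 ≤ cubeSumB c :=
  lemmaB_singleMerge_of_minFaceFacet (minFaceFacet_of_minFace h)

/-- **The facet form of MIN-FACE closes C-005**: mine-1's min-facet inequality for single-merge
maps in every dimension gives C-005 on every finite multigraph at every `p`. -/
theorem C005_of_minFaceFacet (h : SingleMergeMinFaceFacet) : C005 :=
  C005_of_singleMergeLemmaB (lemmaB_singleMerge_of_minFaceFacet h)

/-- **MIN-FACE closes C-005**: the bilinear cross-sum inequality for comparable single-merge maps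
in every dimension gives C-005 on every finite multigraph at every `p`. -/
theorem C005_of_minFace (h : SingleMergeMinFace) : C005 :=
  C005_of_minFaceFacet (minFaceFacet_of_minFace h)

/-- Contraction monotonicity at every coordinate implies the facet form of MIN-FACE (the top facet
alone bounds). -/
theorem minFaceFacet_of_contractionMono (h : SingleMergeContractionMono) : SingleMergeMinFaceFacet :=
  fun c hc k => le_trans (min_le_right _ _) (h c hc k)

end PercRepro
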